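import Mathlib.Data.ZMod.Basic
import Mathlib.Algebra.BigOperators.Fin
import Mathlib.Algebra.BigOperators.Ring.Finset
import Mathlib.Tactic.Ring

/-!
# Crux `CubicForrelation.NearExactIsExact` (stmt-QuantumAdvantage-14043) — n = 12, E1280-even, R2 half: the BOOKKEEPING from the pairing-partner
  equations in the rank-2 frame to the block identities (E0)–(E3) of E1280-HANDPROOFS.md §1

Certificate seat `b2b-cforr-cert` (gen 39).  HONEST FRAMING: kernel-checked Finset algebra (standard axioms); step (L3) of the Lean roadmap in
HOME/b2b-cforr-cert-g39/E1280-HANDPROOFS.md §3.  By itself it says nothing about `θ₁₂`; NOT summit progress.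

SETTING.  Indices `Fin (3 + 9)`: `y a := Fin.castAdd 9 a` (`a : Fin 3`; `y 0, y 1, y 2` = the frame coordinates `y₁, y₂, y₃`) and
`σ s := Fin.natAdd 3 s` (`s : Fin 9`, the nine cell coordinates).  `c, d : Fin (3+9) → Fin (3+9) → Fin (3+9) → ZMod 2` are the coefficient
tensors of the partner 3-vector and of the cubic part of the digit class IN THE ADAPTED FRAME (symmetric under the two transpositions, zero on
repeated indices), satisfying the partner equations `hpair : Σ_{j<k} c p j k · d φ j k = [p = φ]` (transported to the frame by
`tps_pair_covariant`).  The R2 frame fact is `hF1 : d (y 0) j k = [{j,k} = {y 1, y 2}]` (the only monomial containing `y₁` is `y₁y₂y₃`;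
R2-PARTNER.md §2 — the shear removing `y₂y₃·m(s)` is NOT assumed: the term `m` is harmless).  Blocks: `G s t := d (y 1) (σ s) (σ t)`,
`Γ s t := d (y 2) (σ s) (σ t)`, `tb r s t := d (σ r) (σ s) (σ t)` (the descendant `t̄`), `A s t := c (y 1) (σ s) (σ t)`, `B s t := c (y 2) (σ s) (σ t)`,
`cS r s t := c (σ r) (σ s) (σ t)`.
RESULTS: `tpb_sum_lt_split` (splitting `Σ_{j<k}` over `Fin (3+9)` into the `y`-`y`, `y`-`σ` and `σ`-`σ` blocks); `tpb_E0` (`c y₁y₂y₃ = 1`,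
`c y₂y₃σ_s = 0`); `tpb_E1` (`⟨G,A⟩ = ⟨G,B⟩ = ⟨Γ,A⟩ = ⟨Γ,B⟩ = 0`); `tpb_E2` (`⟨ι_f t̄, A⟩ = ⟨ι_f t̄, B⟩ = 0`); `tpb_E3`
(`(G A + Γ B)_{f x} + τ_{f x} = [f = x]`, `τ_{fx} = ⟨ι_f t̄, ι_x cS⟩`).  The leaf files then specialise `t̄` and the light structure of `(G, Γ)`
and call the cores of …TwelvePartnerLeaves.  (Mathlib-only imports: pure bookkeeping.)

References: this work (cert seats g36–g39).  Axioms: the standard three.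
-/

set_option linter.dupNamespace false -- D-0017: single-problem summit ⇒ `QuantumAdvantage.QuantumAdvantage` by design

namespace Summit.QuantumAdvantage.QuantumAdvantage.Theorems.CubicForrelation.NearExactIsExact

open Finset Matrix

/-- Splitting `Σ_{j<k}` over `Fin (3 + n)` into the three blocks. [this work] -/
theorem tpb_sum_lt_split {R : Type*} [AddCommMonoid R] {n : ℕ} (F : Fin (3 + n) → Fin (3 + n) → R) :
    (∑ j, ∑ k, (if j < k then F j k else 0)) =
      (F (Fin.castAdd n 0) (Fin.castAdd n 1) + F (Fin.castAdd n 0) (Fin.castAdd n 2) + F (Fin.castAdd n 1) (Fin.castAdd n 2)) +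
      (∑ s : Fin n, (F (Fin.castAdd n 0) (Fin.natAdd 3 s) + F (Fin.castAdd n 1) (Fin.natAdd 3 s) + F (Fin.castAdd n 2) (Fin.natAdd 3 s))) +
      ∑ s : Fin n, ∑ t : Fin n, (if s < t then F (Fin.natAdd 3 s) (Fin.natAdd 3 t) else 0) := by
  have hyy : ∀ a b : Fin 3, (Fin.castAdd n a < Fin.castAdd n b) ↔ a < b := fun a b => by
    rw [Fin.lt_def, Fin.lt_def]; simp only [Fin.val_castAdd]
  have hys : ∀ (a : Fin 3) (s : Fin n), Fin.castAdd n a < Fin.natAdd 3 s := fun a s => by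
    rw [Fin.lt_def]; simp only [Fin.val_castAdd, Fin.val_natAdd]; omega
  have hsy : ∀ (s : Fin n) (a : Fin 3), ¬ Fin.natAdd 3 s < Fin.castAdd n a := fun s a => by
    rw [Fin.lt_def]; simp only [Fin.val_castAdd, Fin.val_natAdd]; omega
  have hss : ∀ s t : Fin n, (Fin.natAdd 3 s < Fin.natAdd 3 t) ↔ s < t := fun s t => by
    rw [Fin.lt_def, Fin.lt_def]; simp only [Fin.val_natAdd]; omega
  have hin1 : ∀ a : Fin 3, (∑ k : Fin (3 + n), (if Fin.castAdd n a < k then F (Fin.castAdd n a) k else 0)) =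
      (∑ b : Fin 3, (if a < b then F (Fin.castAdd n a) (Fin.castAdd n b) else 0)) + ∑ s : Fin n, F (Fin.castAdd n a) (Fin.natAdd 3 s) := by
    intro a
    rw [Fin.sum_univ_add]
    exact congrArg₂ (· + ·)
      (Finset.sum_congr rfl fun b _ => by
        by_cases h : a < b
        · rw [if_pos ((hyy a b).2 h), if_pos h]
        · rw [if_neg (fun h' => h ((hyy a b).1 h')), if_neg h])
      (Finset.sum_congr rfl fun s _ => by rw [if_pos (hys a s)])
  have hin2 : ∀ s : Fin n, (∑ k : Fin (3 + n), (if Fin.natAdd 3 s < k then F (Fin.natAdd 3 s) k else 0)) =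
      ∑ t : Fin n, (if s < t then F (Fin.natAdd 3 s) (Fin.natAdd 3 t) else 0) := by
    intro s
    rw [Fin.sum_univ_add, Finset.sum_eq_zero (fun b _ => if_neg (hsy s b)), zero_add]
    exact Finset.sum_congr rfl fun t _ => by
      by_cases h : s < t
      · rw [if_pos ((hss s t).2 h), if_pos h]
      · rw [if_neg (fun h' => h ((hss s t).1 h')), if_neg h]
  rw [Fin.sum_univ_add, Finset.sum_congr rfl fun a _ => hin1 a, Finset.sum_congr rfl fun s _ => hin2 s, Finset.sum_add_distrib,
    Fin.sum_univ_three, Fin.sum_univ_three, Fin.sum_univ_three, Fin.sum_univ_three]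
  have h01 : (0 : Fin 3) < 1 := by decide
  have h02 : (0 : Fin 3) < 2 := by decide
  have h12 : (1 : Fin 3) < 2 := by decide
  have h10 : ¬ (1 : Fin 3) < 0 := by decide
  have h20 : ¬ (2 : Fin 3) < 0 := by decide
  have h21 : ¬ (2 : Fin 3) < 1 := by decide
  simp only [lt_irrefl, if_false, h01, h02, h12, if_true, h10, h20, h21, zero_add, add_zero]
  rw [Fin.sum_univ_three]
  simp only [← Finset.sum_add_distrib]

section R2Blocks

variable (c d : Fin (3 + 9) → Fin (3 + 9) → Fin (3 + 9) → ZMod 2)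
  (hcs : ∀ p j k, c p k j = c p j k) (hcc : ∀ p j k, c j p k = c p j k) (hcd : ∀ p j, c p j j = 0)
  (hds : ∀ φ j k, d φ k j = d φ j k) (hdc : ∀ φ j k, d j φ k = d φ j k) (hdd : ∀ φ j, d φ j j = 0)
  (hpair : ∀ p φ, (∑ j, ∑ k, (if j < k then c p j k * d φ j k else 0)) = if p = φ then 1 else 0)
  (hF1 : ∀ j k, d (Fin.castAdd 9 0) j k =
    if (j = Fin.castAdd 9 1 ∧ k = Fin.castAdd 9 2) ∨ (j = Fin.castAdd 9 2 ∧ k = Fin.castAdd 9 1) then 1 else 0)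

/-- A tensor symmetric under both transpositions with zero `(j,j)`-diagonal vanishes whenever two indices coincide. -/
theorem tpb_diag12 (e : Fin (3 + 9) → Fin (3 + 9) → Fin (3 + 9) → ZMod 2)
    (hs : ∀ φ j k, e φ k j = e φ j k) (hc : ∀ φ j k, e j φ k = e φ j k) (hd : ∀ φ j, e φ j j = 0)
    (φ k : Fin (3 + 9)) : e φ φ k = 0 ∧ e φ k φ = 0 := by
  have h1 : e φ φ k = 0 := by rw [hs φ k φ, hc k φ φ, hd]
  exact ⟨h1, by rw [hs φ φ k]; exact h1⟩

include hds hdc hF1 in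
/-- Values of `d` in the frame (from the frame fact `hF1` and the symmetries). -/
theorem tpb_d_vals :
    d (Fin.castAdd 9 1) (Fin.castAdd 9 0) (Fin.castAdd 9 2) = 1 ∧ d (Fin.castAdd 9 2) (Fin.castAdd 9 0) (Fin.castAdd 9 1) = 1 ∧
    (∀ s, d (Fin.castAdd 9 1) (Fin.castAdd 9 0) (Fin.natAdd 3 s) = 0) ∧ (∀ s, d (Fin.castAdd 9 2) (Fin.castAdd 9 0) (Fin.natAdd 3 s) = 0) ∧ (∀ s t, d (Fin.castAdd 9 0) (Fin.natAdd 3 s) (Fin.natAdd 3 t) = 0) ∧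
    (∀ s k, d (Fin.natAdd 3 s) (Fin.castAdd 9 0) k = 0) ∧
    (∀ f, d (Fin.natAdd 3 f) (Fin.castAdd 9 1) (Fin.castAdd 9 2) = d (Fin.castAdd 9 1) (Fin.castAdd 9 2) (Fin.natAdd 3 f)) ∧ (∀ s, d (Fin.castAdd 9 2) (Fin.castAdd 9 1) (Fin.natAdd 3 s) = d (Fin.castAdd 9 1) (Fin.castAdd 9 2) (Fin.natAdd 3 s)) ∧
    (∀ f s, d (Fin.natAdd 3 f) (Fin.castAdd 9 1) (Fin.natAdd 3 s) = d (Fin.castAdd 9 1) (Fin.natAdd 3 f) (Fin.natAdd 3 s)) ∧ (∀ f s, d (Fin.natAdd 3 f) (Fin.castAdd 9 2) (Fin.natAdd 3 s) = d (Fin.castAdd 9 2) (Fin.natAdd 3 f) (Fin.natAdd 3 s)) ∧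
    (∀ s, d (Fin.castAdd 9 0) (Fin.castAdd 9 1) (Fin.natAdd 3 s) = 0) ∧ (∀ s, d (Fin.castAdd 9 0) (Fin.castAdd 9 2) (Fin.natAdd 3 s) = 0) := by
  have ne12 : (Fin.castAdd 9 1 : Fin (3 + 9)) ≠ Fin.castAdd 9 2 := by decide
  have nes1 : ∀ s : Fin 9, (Fin.natAdd 3 s : Fin (3 + 9)) ≠ Fin.castAdd 9 1 := fun s h => by
    have := congrArg Fin.val h; simp only [Fin.val_natAdd, Fin.val_castAdd] at this; omega
  have nes2 : ∀ s : Fin 9, (Fin.natAdd 3 s : Fin (3 + 9)) ≠ Fin.castAdd 9 2 := fun s h => by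
    have := congrArg Fin.val h; simp only [Fin.val_natAdd, Fin.val_castAdd] at this; omega
  have d01s : ∀ s, d (Fin.castAdd 9 0) (Fin.castAdd 9 1) (Fin.natAdd 3 s) = 0 := by
    intro s; rw [hF1, if_neg]; rintro (⟨-, h⟩ | ⟨h, -⟩); exact nes2 s h; exact ne12 h
  have d02s : ∀ s, d (Fin.castAdd 9 0) (Fin.castAdd 9 2) (Fin.natAdd 3 s) = 0 := by
    intro s; rw [hF1, if_neg]; rintro (⟨h, -⟩ | ⟨-, h⟩); exact ne12 h.symm; exact nes1 s h
  refine ⟨?_, ?_, ?_, ?_, ?_, ?_, ?_, ?_, ?_, ?_, d01s, d02s⟩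
  · rw [hdc, hF1, if_pos (Or.inl ⟨rfl, rfl⟩)]
  · rw [hdc, hds, hF1, if_pos (Or.inl ⟨rfl, rfl⟩)]
  · intro s; rw [hdc]; exact d01s s
  · intro s; rw [hdc]; exact d02s s
  · intro s t; rw [hF1, if_neg]; rintro (⟨h, -⟩ | ⟨h, -⟩); exact nes1 s h; exact nes2 s h
  · intro s k; rw [hdc, hF1, if_neg]; rintro (⟨h, -⟩ | ⟨h, -⟩); exact nes1 s h; exact nes2 s h
  · intro f; rw [hdc, hds]
  · intro s; rw [hdc]
  · intro f s; rw [hdc]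
  · intro f s; rw [hdc]

include hds hdc hdd hF1 in
/-- The three expansions of `Σ_{j<k} c_{pjk} d_{φjk}` for `φ = y₂`, `φ = y₃`, `φ = σ_f`. [this work] -/
theorem tpb_keys (p : Fin (3 + 9)) :
    ((∑ j, ∑ k, (if j < k then c p j k * d (Fin.castAdd 9 1) j k else 0)) =
      c p (Fin.castAdd 9 0) (Fin.castAdd 9 2) + (∑ s, c p (Fin.castAdd 9 2) (Fin.natAdd 3 s) * d (Fin.castAdd 9 1) (Fin.castAdd 9 2) (Fin.natAdd 3 s)) + ∑ s, ∑ t, (if s < t then c p (Fin.natAdd 3 s) (Fin.natAdd 3 t) * d (Fin.castAdd 9 1) (Fin.natAdd 3 s) (Fin.natAdd 3 t) else 0)) ∧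
    ((∑ j, ∑ k, (if j < k then c p j k * d (Fin.castAdd 9 2) j k else 0)) =
      c p (Fin.castAdd 9 0) (Fin.castAdd 9 1) + (∑ s, c p (Fin.castAdd 9 1) (Fin.natAdd 3 s) * d (Fin.castAdd 9 1) (Fin.castAdd 9 2) (Fin.natAdd 3 s)) + ∑ s, ∑ t, (if s < t then c p (Fin.natAdd 3 s) (Fin.natAdd 3 t) * d (Fin.castAdd 9 2) (Fin.natAdd 3 s) (Fin.natAdd 3 t) else 0)) ∧
    (∀ f, (∑ j, ∑ k, (if j < k then c p j k * d (Fin.natAdd 3 f) j k else 0)) =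
      c p (Fin.castAdd 9 1) (Fin.castAdd 9 2) * d (Fin.castAdd 9 1) (Fin.castAdd 9 2) (Fin.natAdd 3 f) +
        (∑ s, (c p (Fin.castAdd 9 1) (Fin.natAdd 3 s) * d (Fin.castAdd 9 1) (Fin.natAdd 3 f) (Fin.natAdd 3 s) + c p (Fin.castAdd 9 2) (Fin.natAdd 3 s) * d (Fin.castAdd 9 2) (Fin.natAdd 3 f) (Fin.natAdd 3 s))) +
        ∑ s, ∑ t, (if s < t then c p (Fin.natAdd 3 s) (Fin.natAdd 3 t) * d (Fin.natAdd 3 f) (Fin.natAdd 3 s) (Fin.natAdd 3 t) else 0)) := by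
  obtain ⟨d102, d201, d10s, d20s, -, ds0k, dsf12, d21s, dsf1s, dsf2s, -, -⟩ := tpb_d_vals d hds hdc hF1
  have hd := tpb_diag12 d hds hdc hdd
  refine ⟨?_, ?_, fun f => ?_⟩
  · rw [tpb_sum_lt_split]
    simp only [(hd _ _).1, (hd _ _).2, d102, d10s, mul_one, mul_zero, zero_add, add_zero]
  · rw [tpb_sum_lt_split]
    simp only [(hd _ _).1, (hd _ _).2, d201, d20s, d21s, mul_one, mul_zero, zero_add, add_zero]
  · rw [tpb_sum_lt_split]
    simp only [ds0k, dsf12, dsf1s, dsf2s, mul_zero, zero_add]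

include hcs hcc hcd hds hdc hdd hpair hF1

omit hcd in
/-- **(E0)**: `c_{y₁y₂y₃} = 1` and `c_{y₂y₃σ_s} = 0` — the partner equations at `(p, φ) = (·, y₁)`. [this work] -/
theorem tpb_E0 : c (Fin.castAdd 9 0) (Fin.castAdd 9 1) (Fin.castAdd 9 2) = 1 ∧ ∀ x : Fin 9, c (Fin.castAdd 9 1) (Fin.castAdd 9 2) (Fin.natAdd 3 x) = 0 := by
  obtain ⟨-, -, -, -, d0ss, -, -, -, -, -, d01s, d02s⟩ := tpb_d_vals d hds hdc hF1
  have hd11 : ∀ φ k, d φ φ k = 0 := fun φ k => (tpb_diag12 d hds hdc hdd φ k).1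
  have d012 : d (Fin.castAdd 9 0) (Fin.castAdd 9 1) (Fin.castAdd 9 2) = 1 := by rw [hF1, if_pos (Or.inl ⟨rfl, rfl⟩)]
  have key : ∀ p, (∑ j, ∑ k, (if j < k then c p j k * d (Fin.castAdd 9 0) j k else 0)) = c p (Fin.castAdd 9 1) (Fin.castAdd 9 2) := by
    intro p
    rw [tpb_sum_lt_split]
    simp only [hd11, d012, d01s, d02s, d0ss, mul_zero, mul_one, zero_add, add_zero, Finset.sum_const_zero, ite_self]
  refine ⟨?_, fun x => ?_⟩
  · have h := hpair (Fin.castAdd 9 0) (Fin.castAdd 9 0); rwa [key, if_pos rfl] at h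
  · have h := hpair (Fin.natAdd 3 x) (Fin.castAdd 9 0)
    have hne : (Fin.natAdd 3 x : Fin (3 + 9)) ≠ Fin.castAdd 9 0 := fun h' => by
      have := congrArg Fin.val h'; simp only [Fin.val_natAdd, Fin.val_castAdd] at this; omega
    rw [key, if_neg hne, hcc (Fin.castAdd 9 1) (Fin.natAdd 3 x) (Fin.castAdd 9 2), hcs (Fin.castAdd 9 1) (Fin.castAdd 9 2) (Fin.natAdd 3 x)] at h
    exact h

/-- **(E1)**: `⟨A, G⟩ = ⟨B, Γ⟩ = ⟨A, Γ⟩ = ⟨B, G⟩ = 0` — the partner equations at `(y₂,y₂)`, `(y₃,y₃)`, `(y₂,y₃)`, `(y₃,y₂)`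
(`A = ι_{y₂}c`, `B = ι_{y₃}c`, `G = ι_{y₂}d`, `Γ = ι_{y₃}d` on the cell coordinates). [this work] -/
theorem tpb_E1 :
    (∑ s, ∑ t, (if s < t then c (Fin.castAdd 9 1) (Fin.natAdd 3 s) (Fin.natAdd 3 t) * d (Fin.castAdd 9 1) (Fin.natAdd 3 s) (Fin.natAdd 3 t) else 0)) = 0 ∧
    (∑ s, ∑ t, (if s < t then c (Fin.castAdd 9 2) (Fin.natAdd 3 s) (Fin.natAdd 3 t) * d (Fin.castAdd 9 2) (Fin.natAdd 3 s) (Fin.natAdd 3 t) else 0)) = 0 ∧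
    (∑ s, ∑ t, (if s < t then c (Fin.castAdd 9 1) (Fin.natAdd 3 s) (Fin.natAdd 3 t) * d (Fin.castAdd 9 2) (Fin.natAdd 3 s) (Fin.natAdd 3 t) else 0)) = 0 ∧
    (∑ s, ∑ t, (if s < t then c (Fin.castAdd 9 2) (Fin.natAdd 3 s) (Fin.natAdd 3 t) * d (Fin.castAdd 9 1) (Fin.natAdd 3 s) (Fin.natAdd 3 t) else 0)) = 0 := by
  obtain ⟨c012, c12s⟩ := tpb_E0 c d hcs hcc hds hdc hdd hpair hF1
  have hc := tpb_diag12 c hcs hcc hcd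
  have ne12 : (Fin.castAdd 9 1 : Fin (3 + 9)) ≠ Fin.castAdd 9 2 := by decide
  have c102 : c (Fin.castAdd 9 1) (Fin.castAdd 9 0) (Fin.castAdd 9 2) = 1 := by rw [hcc, c012]
  have c201 : c (Fin.castAdd 9 2) (Fin.castAdd 9 0) (Fin.castAdd 9 1) = 1 := by rw [hcc, hcs, c012]
  have c21s : ∀ s, c (Fin.castAdd 9 2) (Fin.castAdd 9 1) (Fin.natAdd 3 s) = 0 := fun s => by rw [hcc, c12s]
  refine ⟨?_, ?_, ?_, ?_⟩
  · have h := hpair (Fin.castAdd 9 1) (Fin.castAdd 9 1)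
    rw [(tpb_keys c d hds hdc hdd hF1 (Fin.castAdd 9 1)).1, if_pos rfl, c102] at h
    simp only [c12s, zero_mul, Finset.sum_const_zero, add_zero] at h
    rwa [add_eq_left] at h
  · have h := hpair (Fin.castAdd 9 2) (Fin.castAdd 9 2)
    rw [(tpb_keys c d hds hdc hdd hF1 (Fin.castAdd 9 2)).2.1, if_pos rfl, c201] at h
    simp only [c21s, zero_mul, Finset.sum_const_zero, add_zero] at h
    rwa [add_eq_left] at h
  · have h := hpair (Fin.castAdd 9 1) (Fin.castAdd 9 2)
    rw [(tpb_keys c d hds hdc hdd hF1 (Fin.castAdd 9 1)).2.1, if_neg ne12, (hc _ _).2] at h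
    simp only [(hc _ _).1, zero_mul, Finset.sum_const_zero, add_zero, zero_add] at h
    exact h
  · have h := hpair (Fin.castAdd 9 2) (Fin.castAdd 9 1)
    rw [(tpb_keys c d hds hdc hdd hF1 (Fin.castAdd 9 2)).1, if_neg ne12.symm, (hc _ _).2] at h
    simp only [(hc _ _).1, zero_mul, Finset.sum_const_zero, add_zero, zero_add] at h
    exact h

/-- **(E2)**: `⟨A, ι_f t̄⟩ = ⟨B, ι_f t̄⟩ = 0` — the partner equations at `(y₂, σ_f)` and `(y₃, σ_f)`. [this work] -/
theorem tpb_E2 (f : Fin 9) :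
    (∑ s, ∑ t, (if s < t then c (Fin.castAdd 9 1) (Fin.natAdd 3 s) (Fin.natAdd 3 t) * d (Fin.natAdd 3 f) (Fin.natAdd 3 s) (Fin.natAdd 3 t) else 0)) = 0 ∧
    (∑ s, ∑ t, (if s < t then c (Fin.castAdd 9 2) (Fin.natAdd 3 s) (Fin.natAdd 3 t) * d (Fin.natAdd 3 f) (Fin.natAdd 3 s) (Fin.natAdd 3 t) else 0)) = 0 := by
  obtain ⟨-, c12s⟩ := tpb_E0 c d hcs hcc hds hdc hdd hpair hF1
  have hc := tpb_diag12 c hcs hcc hcd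
  have c21s : ∀ s, c (Fin.castAdd 9 2) (Fin.castAdd 9 1) (Fin.natAdd 3 s) = 0 := fun s => by rw [hcc, c12s]
  have ne1 : (Fin.castAdd 9 1 : Fin (3 + 9)) ≠ Fin.natAdd 3 f := fun h => by
    have := congrArg Fin.val h; simp only [Fin.val_natAdd, Fin.val_castAdd] at this; omega
  have ne2 : (Fin.castAdd 9 2 : Fin (3 + 9)) ≠ Fin.natAdd 3 f := fun h => by
    have := congrArg Fin.val h; simp only [Fin.val_natAdd, Fin.val_castAdd] at this; omega
  refine ⟨?_, ?_⟩
  · have h := hpair (Fin.castAdd 9 1) (Fin.natAdd 3 f)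
    rw [(tpb_keys c d hds hdc hdd hF1 (Fin.castAdd 9 1)).2.2 f, if_neg ne1, (hc _ _).1] at h
    simp only [(hc _ _).1, c12s, zero_mul, Finset.sum_const_zero, add_zero, zero_add] at h
    exact h
  · have h := hpair (Fin.castAdd 9 2) (Fin.natAdd 3 f)
    rw [(tpb_keys c d hds hdc hdd hF1 (Fin.castAdd 9 2)).2.2 f, if_neg ne2, (hc _ _).2] at h
    simp only [(hc _ _).1, c21s, zero_mul, Finset.sum_const_zero, add_zero, zero_add] at h
    exact h

omit hcd in
/-- **(E3)**: `(G A + Γ B)_{f x} + τ_{f x} = [f = x]` with `τ_{fx} = ⟨ι_x c_S, ι_f t̄⟩` — the partner equations at `(σ_x, σ_f)`. [this work] -/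
theorem tpb_E3 (f x : Fin 9) :
    (∑ s, (d (Fin.castAdd 9 1) (Fin.natAdd 3 f) (Fin.natAdd 3 s) * c (Fin.castAdd 9 1) (Fin.natAdd 3 s) (Fin.natAdd 3 x) + d (Fin.castAdd 9 2) (Fin.natAdd 3 f) (Fin.natAdd 3 s) * c (Fin.castAdd 9 2) (Fin.natAdd 3 s) (Fin.natAdd 3 x))) +
      (∑ s, ∑ t, (if s < t then c (Fin.natAdd 3 x) (Fin.natAdd 3 s) (Fin.natAdd 3 t) * d (Fin.natAdd 3 f) (Fin.natAdd 3 s) (Fin.natAdd 3 t) else 0)) = if f = x then 1 else 0 := by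
  obtain ⟨-, c12s⟩ := tpb_E0 c d hcs hcc hds hdc hdd hpair hF1
  have h := hpair (Fin.natAdd 3 x) (Fin.natAdd 3 f)
  rw [(tpb_keys c d hds hdc hdd hF1 (Fin.natAdd 3 x)).2.2 f] at h
  have cx12 : c (Fin.natAdd 3 x) (Fin.castAdd 9 1) (Fin.castAdd 9 2) = 0 := by rw [hcc, hcs, c12s]
  rw [cx12, zero_mul, zero_add] at h
  have hiff : (Fin.natAdd 3 x : Fin (3 + 9)) = Fin.natAdd 3 f ↔ f = x := by
    constructor
    · intro h'; have := congrArg Fin.val h'; simp only [Fin.val_natAdd] at this; exact (Fin.ext (by omega)).symm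
    · rintro rfl; rfl
  rw [show (if (Fin.natAdd 3 x : Fin (3 + 9)) = Fin.natAdd 3 f then (1 : ZMod 2) else 0) = if f = x then 1 else 0 from by
    by_cases hfx : f = x
    · rw [if_pos (hiff.2 hfx), if_pos hfx]
    · rw [if_neg (fun h' => hfx (hiff.1 h')), if_neg hfx]] at h
  rw [← h]
  refine congrArg₂ (· + ·) (Finset.sum_congr rfl fun s _ => ?_) rfl
  rw [hcc (Fin.castAdd 9 1) (Fin.natAdd 3 x) (Fin.natAdd 3 s), hcs (Fin.castAdd 9 1) (Fin.natAdd 3 s) (Fin.natAdd 3 x), hcc (Fin.castAdd 9 2) (Fin.natAdd 3 x) (Fin.natAdd 3 s), hcs (Fin.castAdd 9 2) (Fin.natAdd 3 s) (Fin.natAdd 3 x)]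
  ring

end R2Blocks

end Summit.QuantumAdvantage.QuantumAdvantage.Theorems.CubicForrelation.NearExactIsExact
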